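import Summits.ABC.IUTFork.Cor312VolumesRealDH
import Summits.ABC.IUTFork.Cor312VolumesSummandsBridge
import HarnessLib

/-!
# [IUTchIII] Corollary 3.12, statement — the verbatim container of the REAL log-shells ASSEMBLED over all
# places; `BridgeHyps.image_adm`/`image_fin` at the Dupuy–Hilado level

Record-only file (D-0012) of the abc-iut cell (Cor. 3.12 sub-crew, seat abc-iut-c312-5, gen 2; D-0067 TEAM A row
A-0 «finiteness + BridgeHyps at the real setting»); TAKES NO SIDE. Assembles, for c312-5's Dupuy–Hilado-level
signature `Real.logShellsDH X logv` (`X : PilotData F`, `logv` analytic: `Real.LogvAnalyticAt` at every prime),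
the verbatim mono-analytic container of [IUTchIII] Rmk. 3.1.1 (ii)(iii) (kurims `paper:url-4b091feeb646`
pp. 94–96) over ALL places `v_ℚ ∈ 𝕍_ℚ = {∞} ⊔ {primes}`:

* at `v_ℚ = p`: the local pieces of `Cor312VolumesRealDH` on abc-iut-c312-3's real prime packets
  `F_{v_0} ⊗_{ℚ_p} ⋯ ⊗_{ℚ_p} F_{v_j}` (direct product regions over the summands `v⃗`, normalized weighted
  `log μ̄`, Dupuy–Hilado Def. 3.6.1), whose (Ind1)/(Ind2) generator facts are THEOREMS (`generatorsPreserveDH`);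
* at `v_ℚ = ∞`: the TRIVIAL one-point container `LocalPieces.trivial` (every nonempty region admissible, log-volume
  `0`) — a MODELLING CHOICE recorded as such: it is Dupuy–Hilado's convention (their (1.1) has no archimedean
  term; arXiv:2004.13228 §3 works with `𝕃 = Π_p 𝕃_p` over the finite primes only), NOT the "radial" archimedean
  container of [IUTchIII] Rmk. 3.1.1 (iii) (abc-iut-L4-t2/L5-t7 `ArchimedeanPacketLogVolume`, not assembled here);
— `Real.summandPiecesDH X logv hlog : SummandPieces (Real.logShellsDH X logv)` with
**`generatorsPreserve_summandPiecesDH`** (no hypothesis beyond analyticity of `logv`; for `Real.analyticLogv`: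
`summandPiecesDHAnalytic`, `generatorsPreserve_summandPiecesDHAnalytic`). CONSEQUENCES
(`Cor312VolumesSummands`/`…Bridge`) for the situation `Situation.ofShells (Real.logShellsDH X logv) M …` whose
data (a) CARRY these admissible regions and log-volume, and any c312-7 `Cor312.Setting P` over it:
`Real.adm_and_logvol_eq_of_mem_indGroup_DH` — along the whole indeterminacy subgroup `⟨Ind1Family ∪ Ind2Family⟩`
admissible regions keep admissibility and log-volume ([IUTchIII] proof of Cor. 3.12, Step (x), p. 181 l. 5–13;
B's named Prop `MRData.LogvolInvariant` DISCHARGED for this line data); `Real.bridgeHyps_DH` — c312-6's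
`BridgeHyps P` with `mono`, `image_adm`, `image_fin`, `theta_nonempty` DISCHARGED, leaving as named inputs ONLY:
the (Ind3)-enlarged Θ-region is admissible (its image is a product over the summands `v⃗` of sets of positive
finite normalised Haar measure — owner c312-3 `Ind3Datum`) with finitely supported log-volume, hull-sets are
nonempty, and `ThetaFinite` (c312-7 `hullDefined_of_stable`). [claim: Mochizuki2012, status: disputed] for the
quoted container; [cite: DupuyHilado2025, Def. 3.6.1, §4.7, §4.9]. Deliberately NOT here: the archimedean radial
container, the Θ-boxes, the `Cor312.Setting` term itself (c312-7 `Setting.ofComparison`/`ofFrames` over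
`Real.situation`), any judgement.
-/

noncomputable section

open Set Function NumberField IsDedekindDomain

namespace Summit.ABC

namespace IUTFork

namespace Cor312Vol

open Thm311 Literature.IUT.LogThetaLattice

variable {T : ThetaIndex}

namespace LocalPieces

/-- **The TRIVIAL local pieces** at a place: one one-point summand per label, every nonempty set admissible,
log-measure `0`, weight `0`, comparison the constant map. Used at the archimedean place to record Dupuy–Hilado's
convention "no archimedean term" (arXiv:2004.13228 §3: `𝕃 = Π_p 𝕃_p`); a MODELLING CHOICE, not the radial
container of [IUTchIII] Rmk. 3.1.1 (iii). [cite: DupuyHilado2025, Def. 3.6.3] -/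
def trivial (L : LogShells T) (vQ : T.VQ) : LocalPieces L vQ where
  E _ := Unit
  X _ _ := Unit
  adm _ _ R := R.Nonempty
  logμ _ _ _ := 0
  adm_nonempty _ _ _ h := h
  logμ_mono _ _ _ _ _ _ _ := le_rfl
  e _ _ _ := ()
  e_surjective _ := fun _ => ⟨0, rfl⟩
  w _ _ := 0
  w_nonneg _ _ := le_rfl

/-- The identity preserves the trivial container. [folklore] -/
theorem preservesRegions_trivial_id (L : LogShells T) (vQ : T.VQ) (j : T.Label) :
    (trivial L vQ).PreservesRegions j _root_.id :=
  ⟨Function.bijective_id, fun R hR => ⟨R, Set.image_id _, hR, rfl⟩, fun R hR => ⟨R, rfl, hR, rfl⟩⟩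

/-- The trivial local pieces satisfy the generator hypotheses (every generator is intertwined with the
identity of the one-point product). [folklore] -/
theorem generatorsPreserve_trivial (L : LogShells T) (vQ : T.VQ) : (trivial L vQ).GeneratorsPreserve :=
  ⟨fun j _ => ⟨_root_.id, preservesRegions_trivial_id L vQ j, fun _ => rfl⟩,
    fun j _ _ => ⟨_root_.id, preservesRegions_trivial_id L vQ j, fun _ => rfl⟩,
    fun j _ _ => ⟨_root_.id, preservesRegions_trivial_id L vQ j, fun _ => rfl⟩⟩

/-- In the trivial container exactly the nonempty regions are admissible. [folklore] -/
theorem adm_trivial_iff (L : LogShells T) (vQ : T.VQ) (j : T.Label) (A : Set (L.Packet j vQ)) :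
    (trivial L vQ).Adm j A ↔ A.Nonempty := by
  constructor
  · rintro ⟨R, hR, hadm⟩
    have h : ((trivial L vQ).e j '' A).Nonempty := by
      rw [hR]; exact Set.univ_pi_nonempty_iff.2 hadm
    exact h.of_image
  · intro hA
    refine ⟨fun _ => Set.univ, ?_, fun _ => Set.univ_nonempty⟩
    ext y
    simp only [Set.mem_image, Set.mem_univ_pi, Set.mem_univ, implies_true, iff_true]
    obtain ⟨a, ha⟩ := hA
    exact ⟨a, ha, funext fun _ => rfl⟩

end LocalPieces

end Cor312Vol

namespace Thm311

namespace Real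

open Cor312 Cor312Vol Literature.IUT.LogThetaLattice Literature.IUT.LogVolume

variable {F : Type} [Field F] [NumberField F] (X : PilotData F) (logv : PadicLogs F)

/-- `logv` is the analytic logarithm at EVERY prime. [cite: NeukirchANT1999, Ch. II (5.5)] -/
def LogvAnalytic : Prop :=
  ∀ pp : Nat.Primes, haveI : Fact (pp : ℕ).Prime := ⟨pp.2⟩; LogvAnalyticAt (F := F) pp.1 logv

/-- c312-5's `Real.analyticLogv` is analytic at every prime. [cite: NeukirchANT1999, Ch. II (5.5)] -/
theorem logvAnalytic_analyticLogv : LogvAnalytic (F := F) (analyticLogv F) :=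
  fun pp => by haveI : Fact (pp : ℕ).Prime := ⟨pp.2⟩; exact logvAnalyticAt_analyticLogv pp.1

variable {logv}

/-- **The local pieces of the real Dupuy–Hilado-level signature at every place**: the real prime packets at
`v_ℚ = p` (`padicPresentationDH`), the trivial container at `v_ℚ = ∞` (Dupuy–Hilado convention, see the module
docstring). [claim: Mochizuki2012, status: disputed] -/
def localPiecesDH (hlog : LogvAnalytic logv) :
    ∀ vQ : (thetaIndex X).VQ, LocalPieces (logShellsDH X logv) vQ
  | .inl _ => LocalPieces.trivial _ _
  | .inr pp => haveI : Fact (pp : ℕ).Prime := ⟨pp.2⟩; (padicPresentationDH X pp.1 logv (hlog pp)).toLocalPieces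

/-- **The verbatim container of the real log-shells over all places** (`SummandPieces.ofLocal` of
`localPiecesDH`): the binders `Adm`, `logvol` of c312-5's `Real.situation`/`Situation.ofShells` at the
Dupuy–Hilado level, CONCRETE. [claim: Mochizuki2012, status: disputed] -/
def summandPiecesDH (hlog : LogvAnalytic logv) : SummandPieces (logShellsDH X logv) :=
  SummandPieces.ofLocal (localPiecesDH X hlog)

/-- **The generator hypotheses HOLD for the real log-shells** (capsule permutations and Dupuy–Hilado's
(Ind2)-automorphisms preserve direct product regions and their weighted log-volumes, at every place).
[cite: DupuyHilado2025, §4.7, §4.9] -/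
theorem generatorsPreserve_summandPiecesDH (hlog : LogvAnalytic logv) :
    (summandPiecesDH X hlog).GeneratorsPreserve :=
  SummandPieces.generatorsPreserve_ofLocal _ fun vQ =>
    match vQ with
    | .inl u => LocalPieces.generatorsPreserve_trivial (logShellsDH X logv) (.inl u)
    | .inr pp => by haveI : Fact (pp : ℕ).Prime := ⟨pp.2⟩; exact generatorsPreserveDH X pp.1 logv (hlog pp)

/-- The container for the ANALYTIC logarithm family — no hypothesis. [claim: Mochizuki2012, status: disputed] -/
def summandPiecesDHAnalytic : SummandPieces (logShellsDH X (analyticLogv F)) :=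
  summandPiecesDH X (logvAnalytic_analyticLogv (F := F))

/-- … and its generator facts, UNCONDITIONAL. [cite: DupuyHilado2025, §4.7, §4.9] -/
theorem generatorsPreserve_summandPiecesDHAnalytic : (summandPiecesDHAnalytic X).GeneratorsPreserve :=
  generatorsPreserve_summandPiecesDH X _

/-! ## Consequences for the situation of Theorem 3.11 over the real log-shells and settings over it -/

section Consequences

variable (hlog : LogvAnalytic logv) (M : Type) [Field M] [NumberField M]
  (archPk : ∀ (j : (thetaIndex X).Label) (vQ : (thetaIndex X).VQ), Set ((logShellsDH X logv).Packet j vQ))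
  (archSub : ∀ (j : (thetaIndex X).Label) (v : (thetaIndex X).V),
    Set ((logShellsDH X logv).Packet j ((thetaIndex X).over v)))
  (Ψ : ℤ → ∀ v : (thetaIndex X).V, v ∈ (thetaIndex X).Vbad → Set ((logShellsDH X logv).StarPacket v))
  (act : ℤ → ∀ v : (thetaIndex X).V, v ∈ (thetaIndex X).Vbad →
    (logShellsDH X logv).StarPacket v → Module.End ℚ ((logShellsDH X logv).StarPacket v))
  (Mmod : ℤ → ∀ j : (thetaIndex X).LabelStar, Set ((logShellsDH X logv).GlobalPacket j.1))
  (region : ℤ → ∀ j : (thetaIndex X).LabelStar, FinDivisor M → ∀ vQ : (thetaIndex X).VQ,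
    Set ((logShellsDH X logv).Packet j.1 vQ))

/-- The situation of Thm. 3.11 over the real Dupuy–Hilado-level log-shells WITH THE VERBATIM VOLUMES (the
binders `Adm`, `logvol` of c312-5's `Situation.ofShells` := the concrete container; the remaining binders are the
archimedean integral structures and the (b)(c) data). [claim: Mochizuki2012, status: disputed] -/
abbrev situationDHVol : Situation (thetaIndex X) :=
  Situation.ofShells (logShellsDH X logv) M archPk archSub (summandPiecesDH X hlog).Adm
    (summandPiecesDH X hlog).logvol Ψ act Mmod region

/-- Every line of `situationDHVol` carries the verbatim container. [folklore] -/
theorem realizes_situationDHVol (n : ℤ) :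
    (summandPiecesDH X hlog).Realizes ((situationDHVol X hlog M archPk archSub Ψ act Mmod region).D n) :=
  ⟨fun _ _ _ => Iff.rfl, fun _ _ _ => rfl⟩

/-- **(Ind1)/(Ind2) INVARIANCE ALONG THE WHOLE INDETERMINACY SUBGROUP, for the real log-shells**: every
`Φ ∈ ⟨Ind1Family ∪ Ind2Family⟩` of c312-5's Dupuy–Hilado-level signature carries every admissible region of every
packet `𝓘^ℚ(^{S^±_{j+1}};𝒟^⊢_{v_ℚ})` to an admissible region OF THE SAME mono-analytic log-volume ([IUTchIII] proof of
Cor. 3.12, Step (x), p. 181 l. 5–13; Dupuy–Hilado §4.9 footnote) — B's named Prop `MRData.LogvolInvariant`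
and its whole-orbit form, PROVED for this line data (modulo only analyticity of `logv`, discharged by
`Real.analyticLogv`, and the archimedean convention of the module docstring). [claim: Mochizuki2012, status: disputed] -/
theorem adm_and_logvol_eq_of_mem_indGroup_DH (n : ℤ) {Φ : (logShellsDH X logv).PacketAut}
    (hΦ : Φ ∈ Subgroup.closure ((logShellsDH X logv).Ind1Family ∪ (logShellsDH X logv).Ind2Family))
    (j : (thetaIndex X).Label) (vQ : (thetaIndex X).VQ) (A : Set ((logShellsDH X logv).Packet j vQ))
    (hA : ((situationDHVol X hlog M archPk archSub Ψ act Mmod region).D n).Adm j vQ A) :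
    ((situationDHVol X hlog M archPk archSub Ψ act Mmod region).D n).Adm j vQ (Φ j vQ '' A) ∧
      ((situationDHVol X hlog M archPk archSub Ψ act Mmod region).D n).logvol j vQ (Φ j vQ '' A) =
        ((situationDHVol X hlog M archPk archSub Ψ act Mmod region).D n).logvol j vQ A :=
  SummandPieces.adm_and_logvol_eq_of_mem_indGroup (realizes_situationDHVol X hlog M archPk archSub Ψ act Mmod region n)
    (generatorsPreserve_summandPiecesDH X hlog) hΦ j vQ A hA

variable (P : Cor312.Setting (situationDHVol X hlog M archPk archSub Ψ act Mmod region))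

/-- **Every possible image of the Θ-pilot object is admissible with the Θ-region's log-volume**, for any
c312-7 `Cor312.Setting` over the real Dupuy–Hilado-level situation with the verbatim volumes, as soon as the
(Ind3)-enlarged Θ-region itself is admissible ([IUTchIII] Cor. 3.12 "the union of the possible images … subject
to (Ind1), (Ind2), (Ind3)"; proof Step (x)). [claim: Mochizuki2012, status: disputed] -/
theorem adm_and_logvol_possibleImage_eq_DH {j : (thetaIndex X).Label} {vQ : (thetaIndex X).VQ}
    (hθ : ((situationDHVol X hlog M archPk archSub Ψ act Mmod region).D P.n).Adm j vQ (P.thetaRegion3 j vQ))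
    {U : Set ((logShellsDH X logv).Packet j vQ)} (hU : U ∈ P.possibleImages j vQ) :
    ((situationDHVol X hlog M archPk archSub Ψ act Mmod region).D P.n).Adm j vQ U ∧
      ((situationDHVol X hlog M archPk archSub Ψ act Mmod region).D P.n).logvol j vQ U =
        ((situationDHVol X hlog M archPk archSub Ψ act Mmod region).D P.n).logvol j vQ (P.thetaRegion3 j vQ) :=
  SummandPieces.adm_and_logvol_possibleImage_eq
    (realizes_situationDHVol X hlog M archPk archSub Ψ act Mmod region P.n)
    (generatorsPreserve_summandPiecesDH X hlog) hθ hU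

/-- **c312-6's `BridgeHyps` at the Dupuy–Hilado level with `mono`, `image_adm`, `image_fin`, `theta_nonempty`
DISCHARGED**: for a `Cor312.Setting` over the real situation with the verbatim volumes it remains to supply —
the (Ind3)-enlarged Θ-region is admissible at every `(j, v_ℚ)`, `j ∈ 𝔽_l^⋇` (owner: c312-3 `Ind3Datum`) with
finitely supported log-volume over `v_ℚ` (Prop. 3.9 (iii)), hull-sets are nonempty, and `ThetaFinite` (c312-7
`hullDefined_of_stable`). [claim: Mochizuki2012, status: disputed] -/
theorem bridgeHyps_DH
    (hθ : ∀ (i : Fin (thetaIndex X).lstar) (vQ : (thetaIndex X).VQ),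
      ((situationDHVol X hlog M archPk archSub Ψ act Mmod region).D P.n).Adm _ vQ
        (P.thetaRegion3 (Setting.labelSucc i) vQ))
    (hfin : ∀ i : Fin (thetaIndex X).lstar, (Function.support fun vQ : (thetaIndex X).VQ =>
      ((situationDHVol X hlog M archPk archSub Ψ act Mmod region).D P.n).logvol _ vQ
        (P.thetaRegion3 (Setting.labelSucc i) vQ)).Finite)
    (hul_nonempty : ∀ (j : (thetaIndex X).Label) (vQ : (thetaIndex X).VQ), ∀ H ∈ (P.frame j vQ).Hul, H.Nonempty)
    (finite : P.ThetaFinite) : BridgeHyps P :=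
  SummandPieces.bridgeHyps_of_summands (realizes_situationDHVol X hlog M archPk archSub Ψ act Mmod region P.n)
    (generatorsPreserve_summandPiecesDH X hlog) hθ hfin hul_nonempty finite

end Consequences

end Real

end Thm311

end IUTFork

end Summit.ABC

end
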